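import Summits.QuantumFields.YangMills.Theorems.PoincareLipschitzBlowDownModulus
import Summits.QuantumFields.YangMills.Theorems.PoincareLipschitzDiagonalSubsequence
import Summits.QuantumFields.YangMills.Theorems.PoincareLipschitzTranslationModulusCompactness
import Mathlib.MeasureTheory.Function.LpSeminorm.Indicator
import HarnessLib

/-!
# LINE 25 «CompactnessTransfer» (crux `HistoryTailL` stmt-QuantumFields-19936 ∕ K2 crux `BlockLipschitzL` stmt-QuantumFields-23533), S2′ infrastructure —
# FILE E2, THE Γ1 KNIT: ★★★ `blowDown_L2_compact` = THE REGISTERED STUB `stub_blowDownL2Compact` OF LINE 25 v1.3 (SIGNATURE-0 v1 093526177ac80f17 VERBATIM) —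
# `L²`-STRONG COMPACTNESS OF THE PIECEWISE-CONSTANT BLOW-DOWNS OF BOUNDED-ENERGY UNIT LATTICE MAPS, WITH CONVERGENT DYADIC BLOCK MEANS OF THE RESCALED DISCRETE
# GRADIENTS ALONG THE SAME SUBSEQUENCE (generic core `blowDown_L2_compact_core`; floor-cell twin `blowDown_L2_compact_cells` = SIGNATURE-0 v2 6fea8576e966a2a7)

Cell `ym3-torus` (YM ladder rung R3 = continuum SU(2) Yang–Mills on the three-torus — a RUNG, NOT the Clay problem: not d = 4, not infinite volume, not a mass gap);
width seat `ym3-torus-px3` gen 7, the Γ1 seat (LEAD ym-ust-19936-w1 g9 GO 11:10:54Z ∕ PASS on the statement 11:19:21Z ∕ cut 11:21:00Z; ★★OWNER g30 «cite, don't restate»; road of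
record 11:24:48Z).  THEOREMS ONLY (def-free).  Nothing here proves S2′∕S2″, the organ `hImproveCoreFlat`, `BlockLipschitzL`, `HistoryTailL` or any summit statement; Γ1 is
summit-independent lattice analysis.

THE KNIT (every brick BY NAME).  Data `u z R`, `R k ≥ k + 1`, unit values, `Σ_{box (z k) (R k)} Σ_μ ‖δu‖² ≤ Λ₀ R k`.
(1) (c4) FIRST: the family `a k (i, μ) := ∫_{D i} R•δ_μ u(⌊R·x⌋)` over any countable family of measurable cells `D i ⊆ [−1,1)³` is bounded by `√(8Λ₀)` (✓E1
`norm_setIntegral_gradBlowDown_le`), so ✓D `exists_subseq_tendsto_all_of_norm_le` (Tychonoff, px14 g5's probe shape) gives `φ₁` along which ALL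
of them converge.  (2) (c3)+(c2): the zero-extended blow-downs `f_k = 𝟙_{[−1,1)³}·(x ↦ u_k(z_k + ⌊R_k x⌋))` along `φ₁` satisfy the hypotheses of px15 g6's
✓`PoincareLipschitzTranslationModulusCompactness.exists_subseq_limit_of_translate` (= lit ✓`Literature.Analysis.FunctionSpaces.exists_finset_eLpNorm_sub_lt_of_translate`,
Kolmogorov–M. Riesz–Fréchet sufficiency, + completeness + the a.e. constraint): measurable (✓B), vanishing off the compact cube (w7 ✓`isCompact_absCubeClosed`), `L²`-bounded,
and — the one analytic input — UNIFORMLY `L²`-translation-continuous by ✓E1 `eLpNorm_translate_blowDown_sub_le` (= ✓M2b `lintegral_translate_sub_sq_le` fed with ✓M2a and ✓M1); whence `U`, `ψ`, `eLpNorm (f_{φ₁ψn} − U) 2 → 0`, `‖U‖ = 1` a.e. on the open cube.  (3) `φ := φ₁ ∘ ψ`; (c3) is the `lintegral` squeeze of the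
`L²` convergence restricted to the open cube (integrand bounded ⇒ no Bochner vacuity).
[folklore] ([Adams1975] Thm 2.21; [AlicandroCicalese2008] §2, Thm 4.1; [Giaquinta1984] Ch. III §1)
-/

set_option autoImplicit false

noncomputable section

open scoped BigOperators ENNReal
open MeasureTheory Set Filter Topology

namespace Summit.QuantumFields.YangMills.Theorems.PoincareLipschitzBlowDownL2Compactness

open Literature.MathematicalPhysics.QuantumFieldTheory.Balaban1983to89
open B4Eq19LatticeOperators (Zd box unitVec mem_box)
open Summit.QuantumFields.YangMills.Theorems.PoincareLipschitzBlowDownCells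
open Summit.QuantumFields.YangMills.Theorems.PoincareLipschitzLatticeTranslationPaths
open Summit.QuantumFields.YangMills.Theorems.PoincareLipschitzTwoGridCells
open Summit.QuantumFields.YangMills.Theorems.PoincareLipschitzTranslationModulus
open Summit.QuantumFields.YangMills.Theorems.PoincareLipschitzDiagonalSubsequence
open Summit.QuantumFields.YangMills.Theorems.PoincareLipschitzTranslationModulusCompactness
open Summit.QuantumFields.YangMills.Theorems.PoincareLipschitzSamplingCells (isCompact_absCubeClosed isOpen_absCube)

open Summit.QuantumFields.YangMills.Theorems.PoincareLipschitzBlowDownModulus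

/-! ## §5 ★★★ The knit -/

/-- The v1 dyadic cube `Π_i [−1 + 2jᵢ∕2^m, −1 + 2(jᵢ+1)∕2^m)` is measurable. [folklore] -/
theorem measurableSet_dyadicCube (m : ℕ) (j : Fin 3 → Fin (2 ^ m)) :
    MeasurableSet {x : EuclideanSpace ℝ (Fin 3) |
      ∀ i : Fin 3, (-1 : ℝ) + 2 * (j i : ℕ) / (2 : ℝ) ^ m ≤ x i ∧ x i < (-1 : ℝ) + 2 * ((j i : ℕ) + 1) / (2 : ℝ) ^ m} := by
  have : {x : EuclideanSpace ℝ (Fin 3) | ∀ i : Fin 3, (-1 : ℝ) + 2 * (j i : ℕ) / (2 : ℝ) ^ m ≤ x i ∧ x i < (-1 : ℝ) + 2 * ((j i : ℕ) + 1) / (2 : ℝ) ^ m}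
      = ⋂ i : Fin 3, (fun x : EuclideanSpace ℝ (Fin 3) => x i) ⁻¹'
          Set.Ico ((-1 : ℝ) + 2 * (j i : ℕ) / (2 : ℝ) ^ m) ((-1 : ℝ) + 2 * ((j i : ℕ) + 1) / (2 : ℝ) ^ m) := by
    ext x; simp [Set.mem_Ico]
  rw [this]
  exact MeasurableSet.iInter fun i => measurableSet_Ico.preimage (measurable_coord i)

/-- The v1 dyadic cube lies in the half-open cube. [folklore] -/
theorem dyadicCube_subset_halfOpenCube (m : ℕ) (j : Fin 3 → Fin (2 ^ m)) :
    {x : EuclideanSpace ℝ (Fin 3) | ∀ i : Fin 3, (-1 : ℝ) + 2 * (j i : ℕ) / (2 : ℝ) ^ m ≤ x i ∧ x i < (-1 : ℝ) + 2 * ((j i : ℕ) + 1) / (2 : ℝ) ^ m}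
      ⊆ {x | ∀ i, -1 ≤ x i ∧ x i < 1} := by
  intro x hx i
  have h2 : (0 : ℝ) < (2 : ℝ) ^ m := by positivity
  have hj0 : (0 : ℝ) ≤ (j i : ℕ) := Nat.cast_nonneg _
  have hj1 : ((j i : ℕ) : ℝ) + 1 ≤ (2 : ℝ) ^ m := by
    have : (j i : ℕ) + 1 ≤ 2 ^ m := (j i).isLt
    exact_mod_cast this
  obtain ⟨hlo, hhi⟩ := hx i
  constructor
  · have : 0 ≤ 2 * ((j i : ℕ) : ℝ) / (2 : ℝ) ^ m := by positivity
    linarith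
  · have : 2 * (((j i : ℕ) : ℝ) + 1) / (2 : ℝ) ^ m ≤ 2 := by
      rw [div_le_iff₀ h2]; nlinarith
    linarith

/-- ★★★ **THE Γ1 CORE, GENERIC IN THE CELL FAMILY**: for ANY countable family of measurable sets `D i ⊆ [−1,1)³`, the blow-downs have a subsequence with (c1)–(c3) and the
`D i`-means of the rescaled discrete gradients convergent for every `i` and `μ` (Tychonoff over `ι × Fin 3` FIRST, then Kolmogorov–Riesz through px15 g6's
✓`exists_subseq_limit_of_translate` with the uniform modulus §4, then the `lintegral` squeeze on the open cube). [folklore]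
[cite: AlicandroCicalese2008, Thm 4.1; Adams1975, Thm 2.21; Giaquinta1984, Ch. III §1 Thm 1.2] -/
theorem blowDown_L2_compact_core {ι : Type} [Countable ι] (D : ι → Set (EuclideanSpace ℝ (Fin 3)))
    (hDm : ∀ i, MeasurableSet (D i)) (hDQ : ∀ i, D i ⊆ {x | ∀ i, -1 ≤ x i ∧ x i < 1}) :
    ∀ (Λ₀ : ℝ), 0 < Λ₀ → ∀ (u : ℕ → Zd 3 → EuclideanSpace ℝ (Fin 4)) (z : ℕ → Zd 3) (R : ℕ → ℤ),
      (∀ k : ℕ, (k : ℝ) + 1 ≤ R k) → (∀ (k : ℕ) (y : Zd 3), ‖u k y‖ = 1) →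
      (∀ k : ℕ, ∑ y ∈ box (z k) (R k), ∑ μ : Fin 3, ‖(u k) (y + unitVec μ) - (u k) y‖ ^ 2 ≤ Λ₀ * R k) →
      ∃ (U : EuclideanSpace ℝ (Fin 3) → EuclideanSpace ℝ (Fin 4)) (φ : ℕ → ℕ), StrictMono φ ∧
        AEStronglyMeasurable U (volume.restrict {x : EuclideanSpace ℝ (Fin 3) | ∀ i : Fin 3, |x i| < 1}) ∧
        (∀ᵐ x ∂(volume.restrict {x : EuclideanSpace ℝ (Fin 3) | ∀ i : Fin 3, |x i| < 1}), ‖U x‖ = 1) ∧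
        Tendsto (fun k : ℕ => ∫ x in {x : EuclideanSpace ℝ (Fin 3) | ∀ i : Fin 3, |x i| < 1},
            ‖u (φ k) (z (φ k) + fun i => ⌊(R (φ k) : ℝ) * x i⌋) - U x‖ ^ 2) atTop (𝓝 0) ∧
        (∀ (i : ι) (μ : Fin 3), ∃ g : EuclideanSpace ℝ (Fin 4),
          Tendsto (fun k : ℕ => ∫ x in D i,
              (R (φ k) : ℝ) • (u (φ k) ((z (φ k) + fun i => ⌊(R (φ k) : ℝ) * x i⌋) + unitVec μ)
                - u (φ k) (z (φ k) + fun i => ⌊(R (φ k) : ℝ) * x i⌋))) atTop (𝓝 g)) := by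
  intro Λ₀ hΛ₀ u z R hR hu hE
  classical
  ---- integer meshes `N k`, `(N k : ℝ) = (R k : ℝ)`
  have hR1 : ∀ k, (1 : ℤ) ≤ R k := fun k => by
    have h1 : (1 : ℝ) ≤ R k := by linarith [hR k, show (0 : ℝ) ≤ k from Nat.cast_nonneg k]
    exact_mod_cast h1
  obtain ⟨N, hN⟩ : ∃ N : ℕ → ℕ, ∀ k, ((N k : ℕ) : ℤ) = R k :=
    ⟨fun k => (R k).toNat, fun k => Int.toNat_of_nonneg (by linarith [hR1 k])⟩
  have hN1 : ∀ k, 1 ≤ N k := fun k => by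
    have := hR1 k; rw [← hN k] at this; exact_mod_cast this
  have hNR : ∀ k, ((N k : ℕ) : ℝ) = ((R k : ℤ) : ℝ) := fun k => by rw [← hN k]; norm_cast
  have hE' : ∀ k, ∑ y ∈ box (z k) (N k), ∑ μ : Fin 3, ‖u k (y + unitVec μ) - u k y‖ ^ 2 ≤ Λ₀ * (N k : ℝ) := fun k => by
    rw [hN k, hNR k]; exact hE k
  ---- the cubes
  set Q : Set (EuclideanSpace ℝ (Fin 3)) := {x | ∀ i : Fin 3, |x i| < 1} with hQ
  set Q₀ : Set (EuclideanSpace ℝ (Fin 3)) := {x | ∀ i : Fin 3, -1 ≤ x i ∧ x i < 1} with hQ₀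
  set K : Set (EuclideanSpace ℝ (Fin 3)) := {x | ∀ i : Fin 3, |x i| ≤ 1} with hK
  have hQmeas : MeasurableSet Q := (isOpen_absCube 1).measurableSet
  have hQ₀meas : MeasurableSet Q₀ := measurableSet_halfOpenCube
  have hKc : IsCompact K := isCompact_absCubeClosed (by norm_num)
  have hQQ₀ : Q ⊆ Q₀ := openCube_subset_halfOpenCube
  have hQ₀K : Q₀ ⊆ K := halfOpenCube_subset_closedCube
  have hvolQ₀ : volume Q₀ < ∞ := (measure_mono hQ₀K).trans_lt hKc.measure_lt_top
  ---- (1) Tychonoff for the gradient cell means, FIRST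
  set a : ℕ → (ι × Fin 3) → EuclideanSpace ℝ (Fin 4) := fun k p =>
    ∫ x in D p.1, (N k : ℝ) • (u k ((z k + fun i => ⌊(N k : ℝ) * x i⌋) + unitVec p.2) - u k (z k + fun i => ⌊(N k : ℝ) * x i⌋)) with ha_def
  have ha : ∀ k p, ‖a k p‖ ≤ Real.sqrt (8 * Λ₀) := fun k p =>
    norm_setIntegral_gradBlowDown_le (u k) (z k) (N k) (hN1 k) (hE' k) (hDm p.1) (hDQ p.1) p.2
  obtain ⟨lim, φ₁, hφ₁, hconv⟩ := exists_subseq_tendsto_all_of_norm_le a (fun _ => Real.sqrt (8 * Λ₀)) ha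
  ---- (2) Kolmogorov–Riesz along `φ₁`
  set f : ℕ → EuclideanSpace ℝ (Fin 3) → EuclideanSpace ℝ (Fin 4) := fun k =>
    Set.indicator Q₀ (fun x => u k (z k + fun i => ⌊(N k : ℝ) * x i⌋)) with hf_def
  have hum : ∀ n, AEStronglyMeasurable (f (φ₁ n)) volume := fun n =>
    (aestronglyMeasurable_comp_floorVec (fun y' => u (φ₁ n) (z (φ₁ n) + y')) _ volume).indicator hQ₀meas
  have huK : ∀ n x, x ∉ K → f (φ₁ n) x = 0 := fun n x hx =>
    Set.indicator_of_notMem (fun h => hx (hQ₀K h)) _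
  have hbound : ∀ n x, ‖f (φ₁ n) x‖ ≤ ‖Set.indicator Q₀ (fun _ => (1 : ℝ)) x‖ := by
    intro n x
    by_cases hx : x ∈ Q₀
    · rw [hf_def]; simp only []; rw [Set.indicator_of_mem hx, Set.indicator_of_mem hx, hu, Real.norm_eq_abs, abs_one]
    · rw [hf_def]; simp only []; rw [Set.indicator_of_notMem hx, Set.indicator_of_notMem hx, norm_zero, norm_zero]
  have huA : ∀ n, eLpNorm (f (φ₁ n)) 2 volume ≤ ‖(1 : ℝ)‖ₑ * volume Q₀ ^ (1 / (2 : ℝ≥0∞).toReal) := fun n =>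
    (eLpNorm_mono (hbound n)).trans (eLpNorm_indicator_const_le (1 : ℝ) 2)
  have hA : ‖(1 : ℝ)‖ₑ * volume Q₀ ^ (1 / (2 : ℝ≥0∞).toReal) ≠ ∞ :=
    ENNReal.mul_ne_top enorm_ne_top (ENNReal.rpow_ne_top_of_nonneg (div_nonneg zero_le_one ENNReal.toReal_nonneg) hvolQ₀.ne)
  have hmod : ∀ ε : ℝ≥0∞, 0 < ε → ∃ δ : ℝ, 0 < δ ∧
      ∀ n, ∀ y : EuclideanSpace ℝ (Fin 3), ‖y‖ ≤ δ → eLpNorm (fun x => f (φ₁ n) (x - y) - f (φ₁ n) x) 2 volume ≤ ε := by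
    intro ε hε
    set C : ℝ := 288 * Λ₀ + 192 with hC
    have hC0 : 0 < C := by rw [hC]; positivity
    by_cases hεt : ε = ∞
    · refine ⟨1, one_pos, fun n y hy => ?_⟩
      rw [hεt]; exact le_top
    · have he : 0 < ε.toReal := ENNReal.toReal_pos hε.ne' hεt
      refine ⟨min 1 (ε.toReal ^ 2 / C), lt_min one_pos (by positivity), fun n y hy => ?_⟩
      have hδ1 : min 1 (ε.toReal ^ 2 / C) ≤ 1 := min_le_left _ _
      have key := eLpNorm_translate_blowDown_sub_le (u (φ₁ n)) (hu (φ₁ n)) (z (φ₁ n)) (N (φ₁ n)) (hN1 _) hΛ₀.le (hE' _) y hδ1 hy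
      refine key.trans ?_
      have hCδ : C * min 1 (ε.toReal ^ 2 / C) ≤ ε.toReal ^ 2 := by
        calc C * min 1 (ε.toReal ^ 2 / C) ≤ C * (ε.toReal ^ 2 / C) := mul_le_mul_of_nonneg_left (min_le_right _ _) hC0.le
          _ = ε.toReal ^ 2 := by field_simp
      calc ENNReal.ofReal ((288 * Λ₀ + 192) * min 1 (ε.toReal ^ 2 / C)) ^ (1 / 2 : ℝ)
          ≤ ENNReal.ofReal (ε.toReal ^ 2) ^ (1 / 2 : ℝ) := ENNReal.rpow_le_rpow (ENNReal.ofReal_le_ofReal (by rw [← hC]; exact hCδ)) (by norm_num)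
        _ = ENNReal.ofReal ((ε.toReal ^ 2) ^ (1 / 2 : ℝ)) := by rw [ENNReal.ofReal_rpow_of_nonneg (by positivity) (by norm_num)]
        _ = ε := by
            rw [show (1 / 2 : ℝ) = ((2 : ℕ) : ℝ)⁻¹ by norm_num, Real.pow_rpow_inv_natCast he.le two_ne_zero, ENNReal.ofReal_toReal hεt]
  have hnorm : ∀ n, ∀ᵐ x ∂(volume : Measure (EuclideanSpace ℝ (Fin 3))), x ∈ Q → ‖f (φ₁ n) x‖ = 1 := fun n =>
    Filter.Eventually.of_forall fun x hx => by
      rw [hf_def]; simp only []; rw [Set.indicator_of_mem (hQQ₀ hx), hu]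
  obtain ⟨U, ψ, hψ, hUmem, hlim, -, hU1, -⟩ := exists_subseq_limit_of_translate (μ := (volume : Measure (EuclideanSpace ℝ (Fin 3))))
    (p := 2) (by norm_num) ENNReal.ofNat_ne_top hKc (fun n => f (φ₁ n)) hum huK hA huA hmod hnorm
  ---- (3) the conclusions along `φ := φ₁ ∘ ψ`
  refine ⟨U, fun k => φ₁ (ψ k), hφ₁.comp hψ, hUmem.aestronglyMeasurable.restrict, (ae_restrict_iff' hQmeas).2 hU1, ?_, ?_⟩
  · ---- (c3) the `lintegral` squeeze on `Q`
    have hle : ∀ n, ∫⁻ x in Q, ‖f (φ₁ (ψ n)) x - U x‖ₑ ^ 2 ≤ eLpNorm (f (φ₁ (ψ n)) - U) 2 volume ^ 2 := by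
      intro n
      have e : eLpNorm (f (φ₁ (ψ n)) - U) 2 volume ^ 2 = ∫⁻ x, ‖(f (φ₁ (ψ n)) - U) x‖ₑ ^ 2 := by
        rw [eLpNorm_eq_lintegral_rpow_enorm_toReal two_ne_zero ENNReal.ofNat_ne_top, ENNReal.toReal_ofNat, ← ENNReal.rpow_natCast,
          ← ENNReal.rpow_mul]
        norm_num [ENNReal.rpow_two]
      rw [e]
      exact lintegral_mono' Measure.restrict_le_self fun x => le_rfl
    have hsq : Tendsto (fun n => eLpNorm (f (φ₁ (ψ n)) - U) 2 volume ^ 2) atTop (𝓝 0) := by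
      have := ((ENNReal.continuous_pow 2).tendsto 0).comp hlim
      simpa [Function.comp_def] using this
    have hT : Tendsto (fun n => ∫⁻ x in Q, ‖f (φ₁ (ψ n)) x - U x‖ₑ ^ 2) atTop (𝓝 0) :=
      tendsto_of_tendsto_of_tendsto_of_le_of_le tendsto_const_nhds hsq (fun _ => zero_le) hle
    have hT' : Tendsto (fun n => (∫⁻ x in Q, ‖f (φ₁ (ψ n)) x - U x‖ₑ ^ 2).toReal) atTop (𝓝 0) := by
      have := (ENNReal.tendsto_toReal ENNReal.zero_ne_top).comp hT
      simpa [Function.comp_def] using this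
    have hUQ : AEStronglyMeasurable U (volume.restrict Q) := hUmem.aestronglyMeasurable.restrict
    have heq : ∀ n, ∫ x in Q, ‖u (φ₁ (ψ n)) (z (φ₁ (ψ n)) + fun i => ⌊(N (φ₁ (ψ n)) : ℝ) * x i⌋) - U x‖ ^ 2
        = (∫⁻ x in Q, ‖f (φ₁ (ψ n)) x - U x‖ₑ ^ 2).toReal := by
      intro n
      have hbd : AEStronglyMeasurable (fun x => u (φ₁ (ψ n)) (z (φ₁ (ψ n)) + fun i => ⌊(N (φ₁ (ψ n)) : ℝ) * x i⌋)) (volume.restrict Q) :=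
        aestronglyMeasurable_comp_floorVec (fun y' => u (φ₁ (ψ n)) (z (φ₁ (ψ n)) + y')) _ _
      have hfm : AEStronglyMeasurable (fun x => ‖u (φ₁ (ψ n)) (z (φ₁ (ψ n)) + fun i => ⌊(N (φ₁ (ψ n)) : ℝ) * x i⌋) - U x‖ ^ 2)
          (volume.restrict Q) := (continuous_pow 2).comp_aestronglyMeasurable (hbd.sub hUQ).norm
      rw [integral_eq_lintegral_of_nonneg_ae (f := fun x => ‖u (φ₁ (ψ n)) (z (φ₁ (ψ n)) + fun i => ⌊(N (φ₁ (ψ n)) : ℝ) * x i⌋) - U x‖ ^ 2)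
        (Filter.Eventually.of_forall fun x => sq_nonneg _) hfm]
      congr 1
      refine lintegral_congr_ae ((ae_restrict_iff' hQmeas).2 (Filter.Eventually.of_forall fun x hx => ?_))
      rw [hf_def]; simp only []; rw [Set.indicator_of_mem (hQQ₀ hx), ← ofReal_norm, ENNReal.ofReal_pow (norm_nonneg _)]
    have hN_form : Tendsto (fun n => ∫ x in Q, ‖u (φ₁ (ψ n)) (z (φ₁ (ψ n)) + fun i => ⌊(N (φ₁ (ψ n)) : ℝ) * x i⌋) - U x‖ ^ 2) atTop (𝓝 0) := by
      rw [show (fun n => ∫ x in Q, ‖u (φ₁ (ψ n)) (z (φ₁ (ψ n)) + fun i => ⌊(N (φ₁ (ψ n)) : ℝ) * x i⌋) - U x‖ ^ 2)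
          = fun n => (∫⁻ x in Q, ‖f (φ₁ (ψ n)) x - U x‖ₑ ^ 2).toReal from funext heq]
      exact hT'
    simpa only [hNR] using hN_form
  · ---- (c4) the gradient cell means along `φ`
    intro i μ
    refine ⟨lim (i, μ), ?_⟩
    have h1 := (hconv (i, μ)).comp hψ.tendsto_atTop
    have h3 : Tendsto (fun n => ∫ x in D i,
        (N (φ₁ (ψ n)) : ℝ) • (u (φ₁ (ψ n)) ((z (φ₁ (ψ n)) + fun i => ⌊(N (φ₁ (ψ n)) : ℝ) * x i⌋) + unitVec μ)
          - u (φ₁ (ψ n)) (z (φ₁ (ψ n)) + fun i => ⌊(N (φ₁ (ψ n)) : ℝ) * x i⌋))) atTop (𝓝 (lim (i, μ))) := by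
      refine h1.congr' (Filter.Eventually.of_forall fun n => ?_)
      rw [ha_def]; rfl
    simpa only [hNR] using h3

/-- ★★★ **(Γ1-PC) = THE REGISTERED STUB `stub_blowDownL2Compact` OF LINE 25 v1.3 (SIGNATURE-0 v1 093526177ac80f17 VERBATIM: dyadic cubes `Π_i [−1 + 2jᵢ∕2^m,
−1 + 2(jᵢ+1)∕2^m)`)** — `L²`-strong compactness of the piecewise-constant blow-downs of bounded-energy unit lattice maps with convergent dyadic block means of the rescaled
discrete gradients along the same subsequence. [folklore] [cite: AlicandroCicalese2008, Thm 4.1; Adams1975, Thm 2.21; Giaquinta1984, Ch. III §1 Thm 1.2] -/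
theorem blowDown_L2_compact :
    ∀ (Λ₀ : ℝ), 0 < Λ₀ → ∀ (u : ℕ → Zd 3 → EuclideanSpace ℝ (Fin 4)) (z : ℕ → Zd 3) (R : ℕ → ℤ),
      (∀ k : ℕ, (k : ℝ) + 1 ≤ R k) → (∀ (k : ℕ) (y : Zd 3), ‖u k y‖ = 1) →
      (∀ k : ℕ, ∑ y ∈ box (z k) (R k), ∑ μ : Fin 3, ‖(u k) (y + unitVec μ) - (u k) y‖ ^ 2 ≤ Λ₀ * R k) →
      ∃ (U : EuclideanSpace ℝ (Fin 3) → EuclideanSpace ℝ (Fin 4)) (φ : ℕ → ℕ), StrictMono φ ∧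
        AEStronglyMeasurable U (volume.restrict {x : EuclideanSpace ℝ (Fin 3) | ∀ i : Fin 3, |x i| < 1}) ∧
        (∀ᵐ x ∂(volume.restrict {x : EuclideanSpace ℝ (Fin 3) | ∀ i : Fin 3, |x i| < 1}), ‖U x‖ = 1) ∧
        Tendsto (fun k : ℕ => ∫ x in {x : EuclideanSpace ℝ (Fin 3) | ∀ i : Fin 3, |x i| < 1},
            ‖u (φ k) (z (φ k) + fun i => ⌊(R (φ k) : ℝ) * x i⌋) - U x‖ ^ 2) atTop (𝓝 0) ∧
        (∀ (m : ℕ) (j : Fin 3 → Fin (2 ^ m)) (μ : Fin 3), ∃ g : EuclideanSpace ℝ (Fin 4),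
          Tendsto (fun k : ℕ => ∫ x in {x : EuclideanSpace ℝ (Fin 3) |
                ∀ i : Fin 3, (-1 : ℝ) + 2 * (j i : ℕ) / (2 : ℝ) ^ m ≤ x i ∧ x i < (-1 : ℝ) + 2 * ((j i : ℕ) + 1) / (2 : ℝ) ^ m},
              (R (φ k) : ℝ) • (u (φ k) ((z (φ k) + fun i => ⌊(R (φ k) : ℝ) * x i⌋) + unitVec μ)
                - u (φ k) (z (φ k) + fun i => ⌊(R (φ k) : ℝ) * x i⌋))) atTop (𝓝 g)) := by
  intro Λ₀ hΛ₀ u z R hR hu hE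
  obtain ⟨U, φ, hφ, hU, hU1, hc3, hc4⟩ := blowDown_L2_compact_core
    (ι := (m : ℕ) × (Fin 3 → Fin (2 ^ m)))
    (fun p => {x : EuclideanSpace ℝ (Fin 3) |
      ∀ i : Fin 3, (-1 : ℝ) + 2 * (p.2 i : ℕ) / (2 : ℝ) ^ p.1 ≤ x i ∧ x i < (-1 : ℝ) + 2 * ((p.2 i : ℕ) + 1) / (2 : ℝ) ^ p.1})
    (fun p => measurableSet_dyadicCube p.1 p.2) (fun p => dyadicCube_subset_halfOpenCube p.1 p.2) Λ₀ hΛ₀ u z R hR hu hE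
  exact ⟨U, φ, hφ, hU, hU1, hc3, fun m j μ => hc4 ⟨m, j⟩ μ⟩

/-- ★★★ **(Γ1-PC), FLOOR-CELL SPELLING (SIGNATURE-0 v2 6fea8576e966a2a7 VERBATIM: cells `{⌊2^m x⌋ = y}`, `−2^m ≤ yᵢ < 2^m` — FILE B's cells at `R := 2^m`).**
[folklore] [cite: AlicandroCicalese2008, Thm 4.1; Adams1975, Thm 2.21] -/
theorem blowDown_L2_compact_cells :
    ∀ (Λ₀ : ℝ), 0 < Λ₀ → ∀ (u : ℕ → Zd 3 → EuclideanSpace ℝ (Fin 4)) (z : ℕ → Zd 3) (R : ℕ → ℤ),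
      (∀ k : ℕ, (k : ℝ) + 1 ≤ R k) → (∀ (k : ℕ) (y : Zd 3), ‖u k y‖ = 1) →
      (∀ k : ℕ, ∑ y ∈ box (z k) (R k), ∑ μ : Fin 3, ‖(u k) (y + unitVec μ) - (u k) y‖ ^ 2 ≤ Λ₀ * R k) →
      ∃ (U : EuclideanSpace ℝ (Fin 3) → EuclideanSpace ℝ (Fin 4)) (φ : ℕ → ℕ), StrictMono φ ∧
        AEStronglyMeasurable U (volume.restrict {x : EuclideanSpace ℝ (Fin 3) | ∀ i : Fin 3, |x i| < 1}) ∧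
        (∀ᵐ x ∂(volume.restrict {x : EuclideanSpace ℝ (Fin 3) | ∀ i : Fin 3, |x i| < 1}), ‖U x‖ = 1) ∧
        Tendsto (fun k : ℕ => ∫ x in {x : EuclideanSpace ℝ (Fin 3) | ∀ i : Fin 3, |x i| < 1},
            ‖u (φ k) (z (φ k) + fun i => ⌊(R (φ k) : ℝ) * x i⌋) - U x‖ ^ 2) atTop (𝓝 0) ∧
        (∀ (m : ℕ) (y : Zd 3) (μ : Fin 3), (∀ i : Fin 3, -(2 : ℤ) ^ m ≤ y i ∧ y i < (2 : ℤ) ^ m) → ∃ g : EuclideanSpace ℝ (Fin 4),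
          Tendsto (fun k : ℕ => ∫ x in {x : EuclideanSpace ℝ (Fin 3) | ∀ i : Fin 3, ⌊(2 : ℝ) ^ m * x i⌋ = y i},
              (R (φ k) : ℝ) • (u (φ k) ((z (φ k) + fun i => ⌊(R (φ k) : ℝ) * x i⌋) + unitVec μ)
                - u (φ k) (z (φ k) + fun i => ⌊(R (φ k) : ℝ) * x i⌋))) atTop (𝓝 g)) := by
  intro Λ₀ hΛ₀ u z R hR hu hE
  obtain ⟨U, φ, hφ, hU, hU1, hc3, hc4⟩ := blowDown_L2_compact_core
    (ι := {p : ℕ × Zd 3 // ∀ i : Fin 3, -(2 : ℤ) ^ p.1 ≤ p.2 i ∧ p.2 i < (2 : ℤ) ^ p.1})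
    (fun p => {x : EuclideanSpace ℝ (Fin 3) | ∀ i : Fin 3, ⌊(2 : ℝ) ^ p.1.1 * x i⌋ = p.1.2 i})
    (fun p => measurableSet_floorCell _ _) (fun p => cell_subset_halfOpenCube p.1.1 p.2) Λ₀ hΛ₀ u z R hR hu hE
  exact ⟨U, φ, hφ, hU, hU1, hc3, fun m y μ hy => hc4 ⟨(m, y), hy⟩ μ⟩

end Summit.QuantumFields.YangMills.Theorems.PoincareLipschitzBlowDownL2Compactness

end
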